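import Summits.Ventures.CertifiedManyBodySolver.Observables.StiffnessApexTransportMottStationFan
import HarnessLib

/-!
# Ventures/CertifiedManyBodySolver — Observables/StiffnessApexTransportMottStationFanSections.lean

HONEST FRAMING: one-sided certified CEILINGS on the uniform flux stiffness (t–t′ f-sum class) at HALF FILLING (`n = 1`, Mott CONTROL/CALIBRATION line;
`ρ_s = 0` there in print is NOT a theorem here) on whole VERTICAL SECTIONS `{U₀} × [t₁, t₂]` from the «MOTT × FAN» leaves of
`Observables/StiffnessApexTransportMottStationFan.lean` (this seat, g5); conditional on the station / fan nodes; a ceiling never speaks to the presence of order;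
not a `T_c` / superconductivity verdict; no number of record. Zero compute, no definition, no claim node, no `sorry`.

Cell `pub/hubbard-fast` (D-0154 (1)(A)), seat `hubbard-fast-reuse-2` g5 (`prover-hubbard-fast-reuse-2-g5-0`), family «APEX TRANSPORT», line «PH-SIGNED MOTT STATION», device «SECTIONS».

THE POINT. At fixed `U` the station's apex hopping `κ_A = −U_A t′/(U − U_A)` and the fan's `κ_B = (U s − U_B t′)/(U − U_B)` are AFFINE in `t′`, the priced fan member
`−v + (2s − κ_B)A/4` is affine, so the Mott × fan word `[(2t′ − κ_B)X/4 + (κ_A − 2t′)W_B]/(κ_A − κ_B)` is a QUADRATIC over an AFFINE function of `t′`. This file clears the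
denominators ONCE: with `L = (U − U_A)(U − U_B) > 0`, `K_A = −U_A t′(U − U_B)`, `K_B = (U s − U_B t′)(U − U_A)` the leaf inequality is the POLYNOMIAL inequality
`(2t′L − K_B)·X·L + (K_A − 2t′L)(−4vL + (2sL − K_B)A) ≤ 4cL(K_A − K_B)`, and the orientation / side conditions are `K_B ≤ 2sL`, `K_B < 2t′L` — so a section
`{U₀} × [t₁, t₂]` is ONE `nlinarith` certificate (a nonnegative quadratic on an interval: `q₂(t − t⋆)² + m + λ(t − t₁)(t₂ − t)`).

* `ObsStiffnessSeqCeilingAt_halfFilling_mottStation_fanPriced_leftLeaf_cleared` (`t′ ≤ 0`, priced orientation);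
* `ObsStiffnessSeqCeilingAt_halfFilling_mottStation_mirrorFanPriced_rightLeaf_cleared` (`t′ ≥ 0`, the mirrored fan witness, priced orientation).

References: T. Koma, H. Tasaki, J. Stat. Phys. 76 (1994) 745, §1 [KomaTasaki1994]; D. J. Scalapino, S. R. White, S.-C. Zhang, PRB 47 (1993) 7995, §II [ScalapinoWhiteZhang1993];
E. H. Lieb, F. Y. Wu, Physica A 321 (2003) 1, §1 eq. (3) [LiebWuPhysicaA2003].
-/

noncomputable section

namespace Summit.Ventures.CertifiedManyBodySolver.Observables

open Literature.MathematicalPhysics.QuantumLattice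
open Literature.MathematicalPhysics.QuantumLattice.ThermodynamicLimit
open Literature.MathematicalPhysics.QuantumFieldTheory
open Literature.Probability.LatticeModels
open Matrix Finset Filter Topology HubbardWave0
open scoped Matrix BigOperators ComplexOrder

section Cleared

variable {U₀ X s₂ U₂ UP t'P : ℝ}

/-- **MOTT × FAN, `t′ ≤ 0`, PRICED orientation — CLEARED (polynomial) form.** As `…_mottStation_fanPriced_leftLeaf` with the three rational conditions multiplied out by
`L = (U_P − U₀)(U_P − U₂) > 0`: writing `K_A = −U₀ t′ (U_P − U₂)` and `K_B = (U_P s₂ − U₂ t′)(U_P − U₀)` (so `κ_A = K_A/L`, `κ_B = K_B/L`), the hypotheses are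
`K_B ≤ 2s₂L` (priced), `K_B < 2t′L` (fan member left of the target) and the polynomial word inequality
`(2t′L − K_B)·X·L + (K_A − 2t′L)·(−4v₂L + (2s₂L − K_B)A₂) ≤ 4cL(K_A − K_B)`. [cite: KomaTasaki1994, §1] [cite: ScalapinoWhiteZhang1993, §II] -/
theorem ObsStiffnessSeqCeilingAt_halfFilling_mottStation_fanPriced_leftLeaf_cleared (Uo₂ : ℝ) (hU₀ : 0 ≤ U₀)
    (hX : ∀ (ω : InfVolFermionState 2) (Ls : ℕ → ℕ) (ψ : ∀ L, Fock (Orb (FermionTorus 2 L))),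
      Tendsto Ls atTop atTop →
      (∀ j, IsGroundStateInSector (hubbardTorusTT' (Ls j) 1 0 U₀) (rectN 1 (Ls j)) 0 (ψ (Ls j))) →
      (∀ j, star (ψ (Ls j)) ⬝ᵥ ψ (Ls j) = 1) → ω.IsTorusLimitOf ψ Ls →
      -(∑ i : Fin 2, -(1 : ℝ) * ∑ σ : Fin 2,
          ((ω.expect {0, 0 + unitVec i}
              ((cAt 0 (mem_insert_self _ _) σ)ᴴ * cAt (0 + unitVec i) (mem_insert_of_mem (mem_singleton_self _)) σ)).re +
            (ω.expect {0, 0 + unitVec i}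
              ((cAt (0 + unitVec i) (mem_insert_of_mem (mem_singleton_self _)) σ)ᴴ * cAt 0 (mem_insert_self _ _) σ)).re)) ≤ X)
    (hU₂0 : 0 ≤ U₂) {v₂ : ℝ}
    (h₂ : ∀ (ω : InfVolFermionState 2) (Ls : ℕ → ℕ) (ψ : ∀ L, Fock (Orb (FermionTorus 2 L))),
      Tendsto Ls atTop atTop →
      (∀ j, IsGroundStateInSector (hubbardTorusTT' (Ls j) 1 s₂ U₂) (rectN 1 (Ls j)) 0 (ψ (Ls j))) →
      (∀ j, star (ψ (Ls j)) ⬝ᵥ ψ (Ls j) = 1) → ω.IsTorusLimitOf ψ Ls →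
      v₂ ≤ ((Finset.univ : Finset (DihedralGroup 4)).card : ℝ)⁻¹ * ∑ g ∈ (Finset.univ : Finset (DihedralGroup 4)),
        (ω.expect (d4ShiftSet g 0 (box 2 7)) (fermionEmbed (PolySite.d4Emb g 0 (box 2 7)) (-oddMomentObsTT s₂ Uo₂ 0))).re)
    {A₂ : ℝ}
    (hA₂ : ∀ (ω : InfVolFermionState 2) (Ls : ℕ → ℕ) (ψ : ∀ L, Fock (Orb (FermionTorus 2 L))),
      Tendsto Ls atTop atTop →
      (∀ j, IsGroundStateInSector (hubbardTorusTT' (Ls j) 1 s₂ U₂) (rectN 1 (Ls j)) 0 (ψ (Ls j))) →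
      (∀ j, star (ψ (Ls j)) ⬝ᵥ ψ (Ls j) = 1) → ω.IsTorusLimitOf ψ Ls →
      ω.meanEnergy (hubbardTTPrimeFermionInteraction 0 1 0) 1 ≤ A₂)
    (hUA : U₀ < UP) (hUB : U₂ < UP) (ht : t'P ≤ 0)
    (hpricedC : (UP * s₂ - U₂ * t'P) * (UP - U₀) ≤ 2 * s₂ * ((UP - U₀) * (UP - U₂)))
    (hleftC : (UP * s₂ - U₂ * t'P) * (UP - U₀) < 2 * t'P * ((UP - U₀) * (UP - U₂))) (c : ℚ)
    (hpoly : (2 * t'P * ((UP - U₀) * (UP - U₂)) - (UP * s₂ - U₂ * t'P) * (UP - U₀)) * X * ((UP - U₀) * (UP - U₂)) +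
      (-U₀ * t'P * (UP - U₂) - 2 * t'P * ((UP - U₀) * (UP - U₂))) *
        (-4 * v₂ * ((UP - U₀) * (UP - U₂)) + (2 * s₂ * ((UP - U₀) * (UP - U₂)) - (UP * s₂ - U₂ * t'P) * (UP - U₀)) * A₂) ≤
      4 * ((c : ℚ) : ℝ) * ((UP - U₀) * (UP - U₂)) * (-U₀ * t'P * (UP - U₂) - (UP * s₂ - U₂ * t'P) * (UP - U₀))) :
    ObsStiffnessSeqCeilingAt t'P UP 1 c := by
  have hdA : 0 < UP - U₀ := by linarith
  have hdB : 0 < UP - U₂ := by linarith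
  have hL : 0 < (UP - U₀) * (UP - U₂) := mul_pos hdA hdB
  -- the two hoppings in cleared coordinates
  set κA : ℝ := (UP * 0 - U₀ * t'P) / (UP - U₀) with hκA
  set κB : ℝ := (UP * s₂ - U₂ * t'P) / (UP - U₂) with hκB
  have eA : κA * ((UP - U₀) * (UP - U₂)) = -U₀ * t'P * (UP - U₂) := by
    rw [hκA]; field_simp; ring
  have eB : κB * ((UP - U₀) * (UP - U₂)) = (UP * s₂ - U₂ * t'P) * (UP - U₀) := by
    rw [hκB]; field_simp
  have hpriced : κB ≤ 2 * s₂ := by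
    by_contra h
    have h' : 2 * s₂ < κB := lt_of_not_ge h
    nlinarith [mul_lt_mul_of_pos_right h' hL]
  have hleft : κB < 2 * t'P := by
    by_contra h
    have h' : 2 * t'P ≤ κB := le_of_not_gt h
    nlinarith [mul_le_mul_of_nonneg_right h' hL.le]
  refine ObsStiffnessSeqCeilingAt_halfFilling_mottStation_fanPriced_leftLeaf Uo₂ hU₀ hX hU₂0 h₂ hA₂ hUA hUB ht hpriced hleft c ?_
  -- the word inequality: clear κA − κB > 0 and then L > 0
  have hR : 2 * t'P ≤ κA := by
    rw [hκA, le_div_iff₀ hdA]; nlinarith [mul_nonneg_of_nonpos_of_nonpos ht (by linarith : -(2 * UP - U₀) ≤ 0)]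
  have hD : 0 < κA - κB := by linarith
  refine weighted_div_le_of_mul_le hD ?_
  -- multiply the target by L² > 0 and compare with hpoly
  have key : ((2 * t'P - κB) * (X / 4) + (κA - 2 * t'P) * (-v₂ + (2 * s₂ - κB) * A₂ / 4)) * (4 * ((UP - U₀) * (UP - U₂)) ^ 2) =
      (2 * t'P * ((UP - U₀) * (UP - U₂)) - κB * ((UP - U₀) * (UP - U₂))) * X * ((UP - U₀) * (UP - U₂)) +
      (κA * ((UP - U₀) * (UP - U₂)) - 2 * t'P * ((UP - U₀) * (UP - U₂))) *
        (-4 * v₂ * ((UP - U₀) * (UP - U₂)) + (2 * s₂ * ((UP - U₀) * (UP - U₂)) - κB * ((UP - U₀) * (UP - U₂))) * A₂) := by ring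
  have key2 : (((c : ℚ) : ℝ) * (κA - κB)) * (4 * ((UP - U₀) * (UP - U₂)) ^ 2) =
      4 * ((c : ℚ) : ℝ) * ((UP - U₀) * (UP - U₂)) * (κA * ((UP - U₀) * (UP - U₂)) - κB * ((UP - U₀) * (UP - U₂))) := by ring
  have hL2 : 0 < 4 * ((UP - U₀) * (UP - U₂)) ^ 2 := by positivity
  rw [← mul_le_mul_iff_of_pos_right hL2, key, key2, eA, eB]
  exact hpoly

/-- **MOTT × MIRRORED FAN, `t′ ≥ 0`, PRICED orientation — CLEARED (polynomial) form.** As `…_mottStation_mirrorFanPriced_rightLeaf` with `L = (U_P − U₀)(U_P − U₂) > 0`,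
`K_A = −U₀ t′ (U_P − U₂)`, `K_B = (U_P(−s₂) − U₂ t′)(U_P − U₀)` (`κ_A = K_A/L`, `κ_B⁺ = K_B/L`): hypotheses `−K_B ≤ 2s₂L` (priced), `2t′L < K_B` (mirror member right of the
target) and `(K_B − 2t′L)·X·L + (2t′L − K_A)·(−4v₂L + (2s₂L + K_B)A₂) ≤ 4cL(K_B − K_A)`. The `(t′, κ) ↦ (−t′, −κ)` image of the left edition: a `t′ < 0` section
certificate is a `t′ > 0` section certificate with `t⋆ ↦ −t⋆`. [cite: KomaTasaki1994, §1] [cite: LiebWuPhysicaA2003, §1 eq. (3)] -/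
theorem ObsStiffnessSeqCeilingAt_halfFilling_mottStation_mirrorFanPriced_rightLeaf_cleared (Uo₂ : ℝ) (hU₀ : 0 ≤ U₀)
    (hX : ∀ (ω : InfVolFermionState 2) (Ls : ℕ → ℕ) (ψ : ∀ L, Fock (Orb (FermionTorus 2 L))),
      Tendsto Ls atTop atTop →
      (∀ j, IsGroundStateInSector (hubbardTorusTT' (Ls j) 1 0 U₀) (rectN 1 (Ls j)) 0 (ψ (Ls j))) →
      (∀ j, star (ψ (Ls j)) ⬝ᵥ ψ (Ls j) = 1) → ω.IsTorusLimitOf ψ Ls →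
      -(∑ i : Fin 2, -(1 : ℝ) * ∑ σ : Fin 2,
          ((ω.expect {0, 0 + unitVec i}
              ((cAt 0 (mem_insert_self _ _) σ)ᴴ * cAt (0 + unitVec i) (mem_insert_of_mem (mem_singleton_self _)) σ)).re +
            (ω.expect {0, 0 + unitVec i}
              ((cAt (0 + unitVec i) (mem_insert_of_mem (mem_singleton_self _)) σ)ᴴ * cAt 0 (mem_insert_self _ _) σ)).re)) ≤ X)
    (hU₂0 : 0 ≤ U₂) {v₂ : ℝ}
    (h₂ : ∀ (ω : InfVolFermionState 2) (Ls : ℕ → ℕ) (ψ : ∀ L, Fock (Orb (FermionTorus 2 L))),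
      Tendsto Ls atTop atTop →
      (∀ j, IsGroundStateInSector (hubbardTorusTT' (Ls j) 1 s₂ U₂) (rectN 1 (Ls j)) 0 (ψ (Ls j))) →
      (∀ j, star (ψ (Ls j)) ⬝ᵥ ψ (Ls j) = 1) → ω.IsTorusLimitOf ψ Ls →
      v₂ ≤ ((Finset.univ : Finset (DihedralGroup 4)).card : ℝ)⁻¹ * ∑ g ∈ (Finset.univ : Finset (DihedralGroup 4)),
        (ω.expect (d4ShiftSet g 0 (box 2 7)) (fermionEmbed (PolySite.d4Emb g 0 (box 2 7)) (-oddMomentObsTT s₂ Uo₂ 0))).re)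
    {A₂ : ℝ}
    (hA₂ : ∀ (ω : InfVolFermionState 2) (Ls : ℕ → ℕ) (ψ : ∀ L, Fock (Orb (FermionTorus 2 L))),
      Tendsto Ls atTop atTop →
      (∀ j, IsGroundStateInSector (hubbardTorusTT' (Ls j) 1 s₂ U₂) (rectN 1 (Ls j)) 0 (ψ (Ls j))) →
      (∀ j, star (ψ (Ls j)) ⬝ᵥ ψ (Ls j) = 1) → ω.IsTorusLimitOf ψ Ls →
      ω.meanEnergy (hubbardTTPrimeFermionInteraction 0 1 0) 1 ≤ A₂)
    (hUA : U₀ < UP) (hUB : U₂ < UP) (ht : 0 ≤ t'P)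
    (hpricedC : -((UP * (-s₂) - U₂ * t'P) * (UP - U₀)) ≤ 2 * s₂ * ((UP - U₀) * (UP - U₂)))
    (hrightC : 2 * t'P * ((UP - U₀) * (UP - U₂)) < (UP * (-s₂) - U₂ * t'P) * (UP - U₀)) (c : ℚ)
    (hpoly : ((UP * (-s₂) - U₂ * t'P) * (UP - U₀) - 2 * t'P * ((UP - U₀) * (UP - U₂))) * X * ((UP - U₀) * (UP - U₂)) +
      (2 * t'P * ((UP - U₀) * (UP - U₂)) - (-U₀ * t'P * (UP - U₂))) *
        (-4 * v₂ * ((UP - U₀) * (UP - U₂)) + (2 * s₂ * ((UP - U₀) * (UP - U₂)) + (UP * (-s₂) - U₂ * t'P) * (UP - U₀)) * A₂) ≤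
      4 * ((c : ℚ) : ℝ) * ((UP - U₀) * (UP - U₂)) * ((UP * (-s₂) - U₂ * t'P) * (UP - U₀) - (-U₀ * t'P * (UP - U₂)))) :
    ObsStiffnessSeqCeilingAt t'P UP 1 c := by
  have hdA : 0 < UP - U₀ := by linarith
  have hdB : 0 < UP - U₂ := by linarith
  have hL : 0 < (UP - U₀) * (UP - U₂) := mul_pos hdA hdB
  set κA : ℝ := (UP * 0 - U₀ * t'P) / (UP - U₀) with hκA
  set κB : ℝ := (UP * (-s₂) - U₂ * t'P) / (UP - U₂) with hκB
  have eA : κA * ((UP - U₀) * (UP - U₂)) = -U₀ * t'P * (UP - U₂) := by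
    rw [hκA]; field_simp; ring
  have eB : κB * ((UP - U₀) * (UP - U₂)) = (UP * (-s₂) - U₂ * t'P) * (UP - U₀) := by
    rw [hκB]; field_simp
  have hpriced : -κB ≤ 2 * s₂ := by
    by_contra h
    have h' : 2 * s₂ < -κB := lt_of_not_ge h
    nlinarith [mul_lt_mul_of_pos_right h' hL]
  have hright : 2 * t'P < κB := by
    by_contra h
    have h' : κB ≤ 2 * t'P := le_of_not_gt h
    nlinarith [mul_le_mul_of_nonneg_right h' hL.le]
  refine ObsStiffnessSeqCeilingAt_halfFilling_mottStation_mirrorFanPriced_rightLeaf Uo₂ hU₀ hX hU₂0 h₂ hA₂ hUA hUB ht hpriced hright c ?_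
  have hLft : κA ≤ 2 * t'P := by
    rw [hκA, div_le_iff₀ hdA]; nlinarith [mul_nonneg ht (by linarith : 0 ≤ 2 * UP - U₀)]
  have hD : 0 < κB - κA := by linarith
  refine weighted_div_le_of_mul_le hD ?_
  have key : ((κB - 2 * t'P) * (X / 4) + (2 * t'P - κA) * (-v₂ + (2 * s₂ + κB) * A₂ / 4)) * (4 * ((UP - U₀) * (UP - U₂)) ^ 2) =
      (κB * ((UP - U₀) * (UP - U₂)) - 2 * t'P * ((UP - U₀) * (UP - U₂))) * X * ((UP - U₀) * (UP - U₂)) +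
      (2 * t'P * ((UP - U₀) * (UP - U₂)) - κA * ((UP - U₀) * (UP - U₂))) *
        (-4 * v₂ * ((UP - U₀) * (UP - U₂)) + (2 * s₂ * ((UP - U₀) * (UP - U₂)) + κB * ((UP - U₀) * (UP - U₂))) * A₂) := by ring
  have key2 : (((c : ℚ) : ℝ) * (κB - κA)) * (4 * ((UP - U₀) * (UP - U₂)) ^ 2) =
      4 * ((c : ℚ) : ℝ) * ((UP - U₀) * (UP - U₂)) * (κB * ((UP - U₀) * (UP - U₂)) - κA * ((UP - U₀) * (UP - U₂))) := by ring
  have hL2 : 0 < 4 * ((UP - U₀) * (UP - U₂)) ^ 2 := by positivity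
  rw [← mul_le_mul_iff_of_pos_right hL2, key, key2, eA, eB]
  exact hpoly

end Cleared

end Summit.Ventures.CertifiedManyBodySolver.Observables

end
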